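import Literature.AlgebraicGeometry.Resolution.Prop81HeadOfGlue
import Literature.AlgebraicGeometry.Resolution.Prop81Monomialization
import HarnessLib

/-!
# Cossart–Piltant 2019, Prop. 4.8: the pre-stage of Lemma 4.7 over the base of the descent

Topic: `Literature/AlgebraicGeometry/Resolution` (proofs only; no new notions, no new named
facts). In Cossart–Piltant's descent from the formal completion (J. Algebra 529 (2019) =
arXiv:1412.0868, proof of Prop. 4.8 with Lemma 4.7 = [CoP1] Prop. 8.1, arXiv v1 Prop. 4.6
pp. 52–53), the loops of [CoP1] Prop. 8.1 start from a PRINCIPALIZED, MONOMIALIZED state: a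
regular model over the base in which the maximal ideal of the base local ring is generated by one
element `h₀` and the tracked element `F` (a multiple of `h₀ · ι(g f₁ ⋯ f_r) ·` (denominators)) is a
unit times a monomial, all generators having `F`-power denominators ([CoP1] HAL p. 22: "`S₂` …
such that `S₁ < S₂`, `(S₁)_f = (S₂)_f` and each of the ideals `f S₂` and `m_{S₀} S₂` is monomial",
property (1)). `ArithmeticalThreefoldsDescentHeadRun.lean`
(`exists_adjoin_isRegularLocalRing_of_principalizedFrame`) runs the loops from such a state. This
file PRODUCES the state over a regular frame base `S₀` (excellent, of dimension `3`) from: a model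
`S₀[t₁]` principalizing `𝔪` of the base local ring `A_e` by `h₀` with `h₀`-denominators (two
monoidal transforms, `MonoidalPrincipalizeMaximalIdeal.lean`), and an element `g₀ ∈ A_e`
(the product of the `ι(fᵢ)` and of the denominators of the model) — by the embedded-resolution
monomialization with denominator control (`exists_monomialization_with_denominators`, from CJS
Cor. 1.5 `hEmb`) and the rescaling of property (1)
(`exists_model_tracked_of_denominators_subset`), exactly as in the first half of
`head_conclusion_of_monomialization`:

* `exists_principalizedFrame_state` — the state: `t ⊇ t₁`, `R_t` regular with parameters `x`,
  `F = u x^α ∈ A_e` with `Fⁿ t ⊆ A_e`, `h₀ = w x^β` with `∅ ≠ supp β ⊆ supp α`,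
  `𝔪_{A_e} R_t ⊆ h₀ R_t`, `F = g₀ · (…)`, and `v((h₀ g₀)^M) ≤ v(F)` (so `F` is `K`-finite when
  `h₀`, `g₀` are).

## Sources

* V. Cossart, O. Piltant, J. Algebra 320 (2008) 1051–1082: Prop. 8.1 and its proof (HAL
  hal-00139124, pp. 22–23). [CossartPiltant2008]
* V. Cossart, O. Piltant, J. Algebra 529 (2019) 268–535 = arXiv:1412.0868, proof of Prop. 4.8
  with Lemma 4.7 (arXiv v1: Prop. 4.6, pp. 52–53). [CossartPiltant2019]
-/

noncomputable section

open AlgebraicGeometry CategoryTheory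

namespace Literature.AlgebraicGeometry.Resolution

universe u

open IsLocalRing _root_.Polynomial Function

section PreStage

variable {S : Type u} [CommRing S] [IsRegularLocalRing S] {E : Type u} [Field E] [Algebra S E]
  [Algebra.IsAlgebraic S E]

set_option maxHeartbeats 400000 in
omit [IsRegularLocalRing S] [Algebra.IsAlgebraic S E] in
/-- Transport of a regular system of parameters along an equality of local rings of models
(copy of the private lemma of `Prop81HeadOfGlue.lean`). [folklore] -/
private theorem transport_rsop'' (OE : ValuationSubring E) {t₁ t₂ : Set E}
    (h₁ : (Algebra.adjoin S t₁).toSubring ≤ OE.toSubring)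
    (h₂ : (Algebra.adjoin S t₂).toSubring ≤ OE.toSubring)
    (hEq : locAtCentre (Algebra.adjoin S t₁).toSubring OE =
      locAtCentre (Algebra.adjoin S t₂).toSubring OE)
    {d : ℕ} (x' : Fin d → locAtCentre (Algebra.adjoin S t₁).toSubring OE)
    (hspan : haveI := isLocalRing_locAtCentre h₁
      Ideal.span (Set.range x') = maximalIdeal _) :
    ∃ x'' : Fin d → locAtCentre (Algebra.adjoin S t₂).toSubring OE,
      (∀ c, (x'' c : E) = (x' c : E)) ∧
      (haveI := isLocalRing_locAtCentre h₂
       Ideal.span (Set.range x'') = maximalIdeal _) := by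
  haveI := isLocalRing_locAtCentre h₁
  haveI := isLocalRing_locAtCentre h₂
  let e : locAtCentre (Algebra.adjoin S t₁).toSubring OE ≃+*
      locAtCentre (Algebra.adjoin S t₂).toSubring OE :=
    { toFun := fun w => ⟨(w : E), hEq ▸ w.2⟩
      invFun := fun w => ⟨(w : E), hEq.symm ▸ w.2⟩
      left_inv := fun _ => rfl
      right_inv := fun _ => rfl
      map_mul' := fun _ _ => rfl
      map_add' := fun _ _ => rfl }
  refine ⟨fun c => e (x' c), fun c => rfl, ?_⟩
  have hmap : (Ideal.span (Set.range x')).map e.toRingHom =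
      Ideal.span (Set.range fun c => e (x' c)) := by
    rw [Ideal.map_span, ← Set.range_comp]
    rfl
  rw [← hmap, hspan]
  refine le_antisymm (fun y hy => ?_) (fun y hy => ?_)
  · obtain ⟨w, hw, rfl⟩ := (Ideal.mem_map_iff_of_surjective e.toRingHom e.surjective).mp hy
    rw [mem_maximalIdeal_locAtCentre_iff h₂]
    exact (mem_maximalIdeal_locAtCentre_iff h₁ w).mp hw
  · have hvy : OE.valuation (y : E) < 1 := (mem_maximalIdeal_locAtCentre_iff h₂ y).mp hy
    have : y = e.toRingHom (e.symm y) := (e.apply_symm_apply y).symm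
    rw [this]
    exact Ideal.mem_map_of_mem _ ((mem_maximalIdeal_locAtCentre_iff h₁ _).mpr hvy)

set_option maxHeartbeats 3200000 in
/-- **The principalized, monomialized initial state of [CoP1] Prop. 8.1 over the base of the
descent.** Let `S` be an excellent regular local ring of dimension `3` inside a field `E`
algebraic over it (the frame base of Cossart–Piltant's descent), `O_E` a valuation ring
containing and dominating `S` with algebraic residues, `A_e ⊆ E` a subring containing the image
of `S` (the base local ring of the descent), `S[t₁]` a model with regular local ring `R_{t₁} ⊇ A_e`
in which `𝔪_{A_e} R_{t₁} ⊆ h₀ R_{t₁}` for some `0 ≠ h₀ ∈ A_e` of positive value, the generators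
`t₁` having denominator `h₀`, and `0 ≠ g₀ ∈ A_e` divisible in `A_e` by given `f₁, …, f_r ∈ A_e`.
Assume embedded resolution of surfaces (`hEmb`, CJS Cor. 1.5). Then there is a model `S[t]`,
`t ⊇ t₁`, with regular local ring `R_t ⊇ R_{t₁}` and regular parameters `x`, an element
`F ∈ A_e` with `F = u x^α` (`v(u) = 0`), `Fⁿ t ⊆ A_e`, `h₀ = w x^β` with `∅ ≠ supp β ⊆ supp α`,
`𝔪_{A_e} R_t ⊆ h₀ R_t`, the `fᵢ` dividing `F` in `R_t`, `F ∈ g₀ R_t`, and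
`v((h₀ g₀)^M) ≤ v(F)` for some `M`. Proof: `G := h₀ g₀`; monomialization of `G` with denominator
control; rescaling of the generators (property (1)); `F := q′ G`; divisors of powers of `G` are
monomials. [cite: CossartPiltant2008, Prop. 8.1 and proof (HAL pp. 22–23)]
[cite: CossartPiltant2019, proof of Prop. 4.8 with Lemma 4.7 (arXiv v1: Prop. 4.6, pp. 52–53)] -/
theorem exists_principalizedFrame_state
    (hEmb : ∀ (Z : Scheme.{u}) [IsIntegral Z] [IsNoetherian Z], Scheme.IsRegular Z →
      Scheme.IsExcellent Z → ∀ (X : Set Z), IsClosed X → X ≠ Set.univ → topologicalKrullDim X ≤ 2 →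
        ∃ (Z' : Scheme.{u}) (π : Z' ⟶ Z), IsProper π ∧ Function.Surjective π.base ∧
          (∃ U : Z.Opens, (U : Set Z) = Xᶜ ∧ IsIso (π ∣_ U)) ∧
          IsStrictNormalCrossingsDivisor Z' (π.base ⁻¹' X))
    (hS : IsExcellentRing S) (hSdim : ringKrullDim S = 3)
    (hinj : Function.Injective (algebraMap S E))
    (OE : ValuationSubring E) (hSO : ∀ s : S, algebraMap S E s ∈ OE)
    (hdom : ∀ s ∈ maximalIdeal S, OE.valuation (algebraMap S E s) < 1)
    (hres : ∀ y : OE, ∃ q : S[X], (∃ i, q.coeff i ∉ maximalIdeal S) ∧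
      OE.valuation (q.eval₂ (algebraMap S E) y) < 1)
    (Ae : Subring E) (hSA : ∀ s : S, algebraMap S E s ∈ Ae)
    (t₁ : Finset E) (hT₁O : (Algebra.adjoin S (t₁ : Set E)).toSubring ≤ OE.toSubring)
    (hreg₁ : IsRegularLocalRing (locAtCentre (Algebra.adjoin S (t₁ : Set E)).toSubring OE))
    (hAeR : Ae ≤ locAtCentre (Algebra.adjoin S (t₁ : Set E)).toSubring OE)
    (h₀ : E) (hh₀A : h₀ ∈ Ae) (hh₀0 : h₀ ≠ 0) (hvh₀ : OE.valuation h₀ < 1)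
    (hdom₀ : ∀ y ∈ Ae, OE.valuation y < 1 →
      ∃ c ∈ locAtCentre (Algebra.adjoin S (t₁ : Set E)).toSubring OE, y = h₀ * c)
    (hden₁ : ∀ z ∈ (t₁ : Set E), h₀ * z ∈ Ae)
    (g₀ : E) (hg₀A : g₀ ∈ Ae) (hg₀0 : g₀ ≠ 0)
    {r : ℕ} (f : Fin r → E) (hfA : ∀ i, f i ∈ Ae) (hfg : ∀ i, ∃ c ∈ Ae, g₀ = f i * c) :
    ∃ (t : Finset E) (_ : t₁ ⊆ t) (hTO : (Algebra.adjoin S (t : Set E)).toSubring ≤ OE.toSubring)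
      (_ : IsRegularLocalRing (locAtCentre (Algebra.adjoin S (t : Set E)).toSubring OE))
      (_ : locAtCentre (Algebra.adjoin S (t₁ : Set E)).toSubring OE ≤
        locAtCentre (Algebra.adjoin S (t : Set E)).toSubring OE)
      (x : Fin 3 → locAtCentre (Algebra.adjoin S (t : Set E)).toSubring OE)
      (_ : haveI := isLocalRing_locAtCentre hTO
        Ideal.span (Set.range x) = maximalIdeal _)
      (F u : E) (α : Fin 3 → ℕ) (w : E) (β : Fin 3 → ℕ),
      F ∈ Ae ∧ u ∈ locAtCentre (Algebra.adjoin S (t : Set E)).toSubring OE ∧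
      OE.valuation u = 1 ∧ F = u * ∏ c, (x c : E) ^ α c ∧
      (∀ z ∈ (t : Set E), ∃ n : ℕ, F ^ n * z ∈ Ae) ∧
      w ∈ locAtCentre (Algebra.adjoin S (t : Set E)).toSubring OE ∧ OE.valuation w = 1 ∧
      h₀ = w * ∏ c, (x c : E) ^ β c ∧ (∀ c, 0 < β c → 0 < α c) ∧ (∃ c, 0 < β c) ∧
      (∀ y ∈ Ae, OE.valuation y < 1 →
        ∃ c ∈ locAtCentre (Algebra.adjoin S (t : Set E)).toSubring OE, y = h₀ * c) ∧
      (∀ i, f i ∈ locAtCentre (Algebra.adjoin S (t : Set E)).toSubring OE) ∧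
      (∀ i, ∃ c ∈ locAtCentre (Algebra.adjoin S (t : Set E)).toSubring OE, F = f i * c) ∧
      (∃ c ∈ locAtCentre (Algebra.adjoin S (t : Set E)).toSubring OE, F = g₀ * c) ∧
      (∃ M : ℕ, OE.valuation (h₀ * g₀) ^ M ≤ OE.valuation F) := by
  classical
  haveI : IsDomain S := isDomain_of_isRegularLocalRing S
  have hSdim' : ringKrullDim S = (3 : ℕ) := by rw [hSdim]; norm_cast
  have hSuc : IsUniversallyCatenaryRing S := hS.isUniversallyCatenaryRing
  have hSK : ∀ s : S, algebraMap S E s ∈ (⊤ : Subfield E) := fun _ => Subfield.mem_top _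
  have hAO : Ae ≤ OE.toSubring := hAeR.trans (locAtCentre_le hT₁O)
  -- the element to monomialize
  set G : E := h₀ * g₀ with hGdef
  have hGA : G ∈ Ae := Ae.mul_mem hh₀A hg₀A
  have hGR : G ∈ locAtCentre (Algebra.adjoin S (t₁ : Set E)).toSubring OE := hAeR hGA
  have hG0 : G ≠ 0 := mul_ne_zero hh₀0 hg₀0
  have hvG : OE.valuation G < 1 := by
    have h1 : OE.valuation g₀ ≤ 1 := (OE.valuation_le_one_iff _).mpr (hAO hg₀A)
    rw [hGdef, map_mul]
    calc OE.valuation h₀ * OE.valuation g₀ ≤ OE.valuation h₀ * 1 := mul_le_mul_right h1 _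
      _ < 1 := by rw [mul_one]; exact hvh₀
  -- monomialization with denominator control
  obtain ⟨t', htt', -, hT'O, hreg', x, u, α, hx, huR, hvu, hG, hden⟩ :=
    exists_monomialization_with_denominators hEmb hS hSdim hinj OE hSO hdom hres ⊤ hSK t₁
      (fun _ _ => Subfield.mem_top _) hT₁O hreg₁ G hGR hG0 hvG
  have hRR' : locAtCentre (Algebra.adjoin S (t₁ : Set E)).toSubring OE ≤
      locAtCentre (Algebra.adjoin S (t' : Set E)).toSubring OE :=
    locAtCentre_mono OE (Algebra.adjoin_mono (by exact_mod_cast htt'))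
  -- property (1): rescale the new generators
  have hunion : (t₁ : Set E) ∪ ↑(t' \ t₁) = (t' : Set E) := by
    rw [Finset.coe_sdiff, Set.union_sdiff_cancel (by exact_mod_cast htt')]
  obtain ⟨t'', htt'', ht''fin, -, hEq, q', hq'A, hT'', L, c', hc', hL⟩ :=
    exists_model_tracked_of_denominators_subset OE Ae hSA
      (locAtCentre (Algebra.adjoin S (t' : Set E)).toSubring OE) h₀ G hh₀A ⊤ hSK (t' \ t₁)
      (t₁ : Set E) t₁.finite_toSet (fun _ _ => Subfield.mem_top _)
      (fun _ _ => Subfield.mem_top _) hAeR (by rw [hunion]) h₀ hh₀A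
      (fun z hz => ⟨1, by rw [pow_one]; exact hden₁ z hz⟩)
      ⟨1, G, hRR' hGR, by rw [pow_one]⟩
      (fun z hz => by
        obtain ⟨a, b, ha, hb, ha0, hzab, N, c, hc, hN⟩ := hden z (Finset.mem_sdiff.mp hz).1
        exact ⟨a, b, ha, hb, ha0, hzab, N, c, hc, hN⟩)
  rw [hunion] at hEq
  -- the final local ring
  haveI := isLocalRing_locAtCentre hT'O
  haveI hreg'i := hreg'
  have hx0 : ∀ j, (x j : E) ≠ 0 := fun j =>
    coe_rsop_ne_zero_of_frame hSuc hinj OE hSO hdom hres hSdim' (t' : Set E) t'.finite_toSet hT'O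
      hreg' x hx j
  have hdimR : ringKrullDim (locAtCentre (Algebra.adjoin S (t' : Set E)).toSubring OE) = (3 : ℕ) := by
    haveI : Algebra.FiniteType S (Algebra.adjoin S (t' : Set E)) :=
      (Subalgebra.fg_iff_finiteType _).mp (Subalgebra.fg_adjoin_finset _)
    rw [ringKrullDim_locAtCentre_eq_of_frame hSuc hinj OE hSO hdom hres
      (Algebra.adjoin S (t' : Set E)) hT'O, hSdim']
  have hd : (maximalIdeal (locAtCentre (Algebra.adjoin S (t' : Set E)).toSubring OE)).spanFinrank = 3 := by
    have h := IsRegularLocalRing.spanFinrank_maximalIdeal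
      (R := (locAtCentre (Algebra.adjoin S (t' : Set E)).toSubring OE))
    rw [hdimR] at h
    exact_mod_cast h
  have hprime : ∀ c, Prime (x c) := fun c => by
    have h := isPrime_span_image hd x hx {c}
    rw [Finset.coe_singleton, Set.image_singleton] at h
    refine (Ideal.span_singleton_prime ?_).mp h
    intro h0
    exact hx0 c (by rw [h0]; rfl)
  have hval1 : ∀ w : (locAtCentre (Algebra.adjoin S (t' : Set E)).toSubring OE), IsUnit w →
      OE.valuation (w : E) = 1 := fun w hw => by
    by_contra hne
    have hlt : OE.valuation (w : E) < 1 :=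
      lt_of_le_of_ne ((OE.valuation_le_one_iff _).mpr (locAtCentre_le hT'O w.2)) hne
    exact (not_isUnit_locAtCentre_iff hT'O w).mpr hlt hw
  have hu0 : u ≠ 0 := ne_zero_of_valuation_eq_one hvu
  have huinv : u⁻¹ ∈ (locAtCentre (Algebra.adjoin S (t' : Set E)).toSubring OE) :=
    inv_mem_locAtCentre huR hvu
  -- divisors of powers of `G` in the final local ring are monomials
  have hmono : ∀ y : E, y ∈ locAtCentre (Algebra.adjoin S (t' : Set E)).toSubring OE →
      (∃ (n : ℕ) (c : E), c ∈ locAtCentre (Algebra.adjoin S (t' : Set E)).toSubring OE ∧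
        G ^ n = y * c) →
      ∃ (γ : E) (a : Fin 3 → ℕ), γ ∈ locAtCentre (Algebra.adjoin S (t' : Set E)).toSubring OE ∧
        OE.valuation γ = 1 ∧ y = γ * ∏ c, (x c : E) ^ a c := by
    intro y hy ⟨n, cy, hcy, hGy⟩
    have hdvd : (⟨y, hy⟩ : locAtCentre (Algebra.adjoin S (t' : Set E)).toSubring OE) ∣
        ∏ c, x c ^ (n * α c) := by
      refine ⟨⟨cy, hcy⟩ * ⟨u⁻¹, huinv⟩ ^ n, Subtype.ext ?_⟩
      simp only [Subring.coe_mul, SubmonoidClass.coe_finsetProd, SubmonoidClass.coe_pow]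
      have h1 : (∏ c, (x c : E) ^ (n * α c)) = (u⁻¹) ^ n * G ^ n := by
        rw [hG, mul_pow, ← mul_assoc, ← mul_pow, inv_mul_cancel₀ hu0, one_pow, one_mul,
          ← Finset.prod_pow]
        exact Finset.prod_congr rfl fun c _ => by rw [← pow_mul, mul_comm]
      rw [h1, hGy]; ring
    obtain ⟨γu, a, hγa⟩ :=
      CossartPiltantMonomial.exists_eq_units_mul_prod_pow_of_dvd hprime _ hdvd
    refine ⟨(γu : locAtCentre (Algebra.adjoin S (t' : Set E)).toSubring OE), a, γu.val.2,
      hval1 _ γu.isUnit, ?_⟩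
    have := congrArg Subtype.val hγa
    simpa only [Subring.coe_mul, SubmonoidClass.coe_finsetProd, SubmonoidClass.coe_pow] using this
  -- `q'` and `h₀` divide powers of `G`
  have hq'R : q' ∈ locAtCentre (Algebra.adjoin S (t' : Set E)).toSubring OE := hRR' (hAeR hq'A)
  have hh₀R : h₀ ∈ locAtCentre (Algebra.adjoin S (t' : Set E)).toSubring OE := hRR' (hAeR hh₀A)
  have hg₀R : g₀ ∈ locAtCentre (Algebra.adjoin S (t' : Set E)).toSubring OE := hRR' (hAeR hg₀A)
  have hG2L : G ^ (2 * L) = q' * (c' * g₀ ^ L) := by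
    have h1 : G ^ (2 * L) = (h₀ * G) ^ L * g₀ ^ L := by
      rw [pow_mul, sq, show G * G = (h₀ * G) * g₀ by rw [hGdef]; ring, mul_pow]
    rw [h1, hL]; ring
  obtain ⟨γq, aq, hγqR, hvγq, hq'mono⟩ := hmono q' hq'R ⟨2 * L, _,
    Subring.mul_mem _ hc' (Subring.pow_mem _ hg₀R _), hG2L⟩
  obtain ⟨w₀, β, hw₀R, hvw₀, hh₀mono⟩ := hmono h₀ hh₀R ⟨1, g₀, hg₀R, by rw [pow_one, hGdef]⟩
  -- the tracked monomial `F := q' G`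
  set F : E := q' * G with hFdef
  have hFA : F ∈ Ae := Ae.mul_mem hq'A hGA
  have hFmono : F = (γq * u) * ∏ c, (x c : E) ^ (aq c + α c) := by
    rw [hFdef, hq'mono, hG]
    simp only [pow_add, Finset.prod_mul_distrib]
    ring
  have hγquR : γq * u ∈ locAtCentre (Algebra.adjoin S (t' : Set E)).toSubring OE :=
    Subring.mul_mem _ hγqR huR
  have hvγqu : OE.valuation (γq * u) = 1 := by rw [map_mul, hvγq, hvu, one_mul]
  have hTRF : ∀ z ∈ t'', ∃ n : ℕ, F ^ n * z ∈ Ae := fun z hz => by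
    obtain ⟨n, hn⟩ := hT'' z hz
    refine ⟨n, ?_⟩
    rw [hFdef, mul_pow, mul_comm (q' ^ n), mul_assoc]
    exact Ae.mul_mem (Ae.pow_mem hGA _) hn
  have hβα : ∀ c, 0 < β c → 0 < aq c + α c := by
    intro c hc
    have hh₀' : (⟨h₀, hh₀R⟩ : locAtCentre (Algebra.adjoin S (t' : Set E)).toSubring OE) =
        ⟨w₀, hw₀R⟩ * ∏ k, x k ^ β k :=
      Subtype.ext (by
        simp only [Subring.coe_mul, SubmonoidClass.coe_finsetProd, SubmonoidClass.coe_pow]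
        exact hh₀mono)
    have hxh₀ : x c ∣ (⟨h₀, hh₀R⟩ : locAtCentre (Algebra.adjoin S (t' : Set E)).toSubring OE) := by
      rw [hh₀']
      exact Dvd.dvd.mul_left ((dvd_pow_self (x c) hc.ne').trans
        (Finset.dvd_prod_of_mem (fun k => x k ^ β k) (Finset.mem_univ c))) _
    have hxF : x c ∣ (⟨γq * u, hγquR⟩ : locAtCentre (Algebra.adjoin S (t' : Set E)).toSubring OE) *
        ∏ k, x k ^ (aq k + α k) := by
      have h1 : (⟨h₀, hh₀R⟩ : locAtCentre (Algebra.adjoin S (t' : Set E)).toSubring OE) ∣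
          ⟨γq * u, hγquR⟩ * ∏ k, x k ^ (aq k + α k) := by
        refine ⟨⟨q' * g₀, Subring.mul_mem _ hq'R hg₀R⟩, Subtype.ext ?_⟩
        simp only [Subring.coe_mul, SubmonoidClass.coe_finsetProd, SubmonoidClass.coe_pow]
        rw [← hFmono, hFdef, hGdef]; ring
      exact hxh₀.trans h1
    exact pos_of_rsop_dvd_monomial hSuc hinj OE hSO hdom hres hSdim' (t' : Set E) t'.finite_toSet
      hT'O hreg' x hx ⟨γq * u, hγquR⟩ hvγqu _ c hxF
  have hβne : ∃ c, 0 < β c := by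
    by_contra hnone
    push Not at hnone
    have hβ0 : ∀ c, β c = 0 := fun c => Nat.eq_zero_of_le_zero (hnone c)
    have : h₀ = w₀ := by
      rw [hh₀mono]
      simp only [hβ0, pow_zero, Finset.prod_const_one, mul_one]
    rw [this, hvw₀] at hvh₀
    exact lt_irrefl _ hvh₀
  -- the value bound: `F c' = (h₀ G)^L G`, so `v((h₀ g₀)^{2L+1}) ≤ v(F)`
  have hvalF : OE.valuation (h₀ * g₀) ^ (2 * L + 1) ≤ OE.valuation F := by
    have hc'1 : OE.valuation c' ≤ 1 := (OE.valuation_le_one_iff _).mpr (locAtCentre_le hT'O hc')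
    have hkey : F * c' = (h₀ * G) ^ L * G := by rw [hFdef, mul_right_comm, ← hL]
    have h1 : OE.valuation ((h₀ * G) ^ L * G) ≤ OE.valuation F := by
      rw [← hkey, map_mul]
      exact mul_le_of_le_one_right' hc'1
    refine le_trans ?_ h1
    rw [← map_pow, ← hGdef]
    have h2 : (G : E) ^ (2 * L + 1) = (h₀ * G) ^ L * G * g₀ ^ L := by
      rw [hGdef]; ring
    have hg₀1 : OE.valuation (g₀ ^ L) ≤ 1 :=
      (OE.valuation_le_one_iff _).mpr (OE.pow_mem (hAO hg₀A) _)
    calc OE.valuation (G ^ (2 * L + 1)) = OE.valuation ((h₀ * G) ^ L * G) * OE.valuation (g₀ ^ L) := by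
          rw [h2, map_mul]
      _ ≤ OE.valuation ((h₀ * G) ^ L * G) * 1 := mul_le_mul_right hg₀1 _
      _ = OE.valuation ((h₀ * G) ^ L * G) := mul_one _
  -- transport to the rescaled model `S[t'']`
  have hT''O : (Algebra.adjoin S t'').toSubring ≤ OE.toSubring := by
    refine model_toSubring_le_valuationSubring OE hSO fun z hz => ?_
    have : z ∈ locAtCentre (Algebra.adjoin S t'').toSubring OE :=
      le_locAtCentre _ _ (Algebra.subset_adjoin hz)
    rw [hEq] at this
    exact locAtCentre_le hT'O this
  obtain ⟨x'', hx''E, hx''span⟩ := transport_rsop'' OE hT'O hT''O hEq.symm x hx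
  have hreg'' : IsRegularLocalRing (locAtCentre (Algebra.adjoin S t'').toSubring OE) := by
    rw [hEq]; exact hreg'
  have hmem : ∀ {y : E}, y ∈ locAtCentre (Algebra.adjoin S (t' : Set E)).toSubring OE →
      y ∈ locAtCentre (Algebra.adjoin S t'').toSubring OE := fun hy => by rw [hEq]; exact hy
  obtain ⟨tf, rfl⟩ : ∃ tf : Finset E, (tf : Set E) = t'' := ⟨ht''fin.toFinset, ht''fin.coe_toFinset⟩
  have ht₁tf : t₁ ⊆ tf := fun z hz => by
    have : z ∈ (tf : Set E) := htt'' (Finset.mem_coe.mpr hz)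
    exact Finset.mem_coe.mp this
  refine ⟨tf, ht₁tf, hT''O, hreg'', ?_, x'', hx''span, F, γq * u, fun c => aq c + α c, w₀, β, hFA,
    hmem hγquR, hvγqu, ?_, hTRF, hmem hw₀R, hvw₀, ?_, hβα, hβne, ?_, fun i => hmem (hRR' (hAeR (hfA i))),
    fun i => ?_, ⟨q' * h₀, hmem (Subring.mul_mem _ hq'R hh₀R), by rw [hFdef, hGdef]; ring⟩,
    ⟨2 * L + 1, hvalF⟩⟩
  · intro y hy; exact hmem (hRR' hy)
  · simp only [hx''E]; exact hFmono
  · simp only [hx''E]; exact hh₀mono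
  · intro y hy hvy
    obtain ⟨c, hc, hyc⟩ := hdom₀ y hy hvy
    exact ⟨c, hmem (hRR' hc), hyc⟩
  · obtain ⟨c, hcA, hgc⟩ := hfg i
    refine ⟨q' * h₀ * c, hmem (Subring.mul_mem _ (Subring.mul_mem _ hq'R hh₀R)
      (hRR' (hAeR hcA))), ?_⟩
    rw [hFdef, hGdef, hgc]; ring

end PreStage

end Literature.AlgebraicGeometry.Resolution

end
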